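import Mathlib
import HarnessLib
import Summits.AtomisticToContinuum.HydrodynamicLimit.Theses.OneFlightGossipEngine
import Literature.Analysis.FluidPDE.HardSphereCollisionRecord

/-!
# Sketch — crux-ideate stmt-AtomisticToContinuum-14535 (OneFlightLayeredChaos), ideator 2, round 1

First lemmas of the idea cards (signatures only; `sorry`/`Prop` defs, must elaborate):

* `markOfSelectedIndex` — tool lemma of card `comoving-tube-marking` (the finite surrogate of
  the Poisson marking theorem, Last–Penrose 2017 Thm 5.6: the mark of an index selected by the
  ground data is a fresh uniform mark).
* `FirstFlightMarking` — first checkable rung of card `comoving-tube-marking`: the crux's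
  conclusion for `n = 0` with the σ-algebra of the COARSE INITIAL DATA (cells of all positions +
  exact velocities at time 0) and the first partner's identity — no random snapshot times, no
  two-snapshot posterior; pure germ–grain/marking situation.
* `TwoSnapshotMarking` — first checkable rung of card `slider-coordinates-brunn-minkowski`: the
  same conclusion for the first collision of `i` after a FIXED time `s`, conditionally on the coarse
  configurations (cells + exact velocities of all particles) at the two fixed times `0` and `s` —
  isolates the exact-velocity two-snapshot posterior (slider coordinates) from the Palm/random-time
  bookkeeping of the crux.
-/

namespace Summit.AtomisticToContinuum.HydrodynamicLimit.Cruxes.OneFlightLayeredChaos.IdeatorTwo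

open MeasureTheory

/-- Tool lemma (card comoving-tube-marking, stub L2): if the marks `Bm` are i.i.d. `ν` and
independent of the ground data `S`, then the mark of any index measurably SELECTED from the
ground data is `ν`-distributed and independent of the ground data. Finite surrogate of the
marking theorem [LastPenrose2017, Thm 5.6]. -/
theorem markOfSelectedIndex
    {Ω : Type*} [MeasurableSpace Ω] (P : Measure Ω) [IsProbabilityMeasure P]
    {K : ℕ} {S : Ω → (Fin K → ℝ)}
    {Bm : Ω → (Fin K → Literature.MathematicalPhysics.KineticTheory.V3)}
    (hS : Measurable S) (hB : Measurable Bm)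
    (ν : Measure Literature.MathematicalPhysics.KineticTheory.V3) [IsProbabilityMeasure ν]
    (hlaw : P.map Bm = Measure.pi (fun _ : Fin K => ν))
    (hind : ProbabilityTheory.IndepFun S Bm P)
    (f : (Fin K → ℝ) → Fin K) (hf : Measurable f) :
    P.map (fun ω => (Bm ω (f (S ω)), S ω)) = ν.prod (P.map S) := by
  sorry

/-- FIRST LEMMA of card `comoving-tube-marking` (rung `n = 0`, coarse INITIAL data): for the
equilibrium gas, the outgoing direction of the FIRST collision of particle `i` after time `0` is
near-uniform on `S²` and near-independent of (the `r_N`-cells of all initial positions, the exact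
initial velocities of all particles, the identity of the first partner), in the crux's averaged
form, with a polynomial rate in `σ`. Same frame and quantifier order as the crux
`OneFlightLayeredChaos` (stmt-14535); only the conditioning σ-algebra differs (a FIXED-time coarse
configuration instead of the coarse past at the two flight starts). -/
def FirstFlightMarking : Prop :=
  ∀ (a₀ θ₀ : ℝ), 0 < a₀ → 0 < θ₀ → ∃ C : ℝ, 0 < C ∧ ∃ p : ℝ, 0 < p ∧ ∃ σ₀ : ℝ, 0 < σ₀ ∧ ∀ σ : ℝ, 0 < σ → σ < σ₀ → ∃ ρ : ℝ, σ ≤ ρ ∧ ρ * (Real.sqrt 2 * Real.pi * σ ^ 2) ≤ 1 ∧ ∀ τ : ℝ, 0 < τ → ∃ N₀ : ℕ, ∀ N : ℕ, N₀ ≤ N → ∀ Φ : Literature.Analysis.FluidPDE.HardSphereFlow (Literature.Analysis.FluidPDE.Torus.geometry (Fin 3)) (Literature.MathematicalPhysics.KineticTheory.hsDiameter σ N) (N + 1), ∀ (i : Fin (N + 1)) (B : Set Literature.MathematicalPhysics.KineticTheory.V3), MeasurableSet B → let G : Literature.Analysis.FluidPDE.Geometry (Fin 3) Literature.MathematicalPhysics.KineticTheory.T3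 := Literature.Analysis.FluidPDE.Torus.geometry (Fin 3); let ε : ℝ := Literature.MathematicalPhysics.KineticTheory.hsDiameter σ N; let w : ℝ := τ * ((N + 1 : ℕ) : ℝ) ^ (-(1 / 3 : ℝ)); let q : Literature.MathematicalPhysics.KineticTheory.T3 → (Fin 3 → ℤ) := Literature.Analysis.FluidPDE.Torus.coarseCell (ρ * ((N + 1 : ℕ) : ℝ) ^ (-(1 / 3 : ℝ))); let P : MeasureTheory.Measure (Literature.Analysis.FluidPDE.Config (N + 1) (Fin 3) Literature.MathematicalPhysics.KineticTheory.T3) := Literature.MathematicalPhysics.KineticTheory.localGibbsLaw σ (fun _ => a₀) (fun _ => 0) (fun _ => θ₀) N Φ; let W : Set (Literature.Analysis.FluidPDE.Config (N + 1) (Fin 3) Literature.MathematicalPhysics.KineticTheory.T3) := {z | 1 ≤ Set.ncard (Literature.Analysis.FluidPDE.collisionTimesOf G ε (fun t => Φ.flow t z) i ∩ Set.Ioc 0 w)}; let A : Set (Literature.Analysis.FluidPDE.Config (N + 1) (Fin 3) Literature.MathematicalPhysics.KineticTheory.T3) := {z | (Φ.nthRecordOf i 0 z).outDir ∈ B}; let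 u : ℝ := (((Literature.MathematicalPhysics.KineticTheory.sphereMeasure (E := Literature.MathematicalPhysics.KineticTheory.V3)) Set.univ)⁻¹ * (Literature.MathematicalPhysics.KineticTheory.sphereMeasure (E := Literature.MathematicalPhysics.KineticTheory.V3)) {ω | (ω : Literature.MathematicalPhysics.KineticTheory.V3) ∈ B}).toReal; ∀ E : Set (Literature.Analysis.FluidPDE.Config (N + 1) (Fin 3) Literature.MathematicalPhysics.KineticTheory.T3), MeasurableSet[MeasurableSpace.comap (fun z => (Literature.Analysis.FluidPDE.coarseConfig q z, Φ.nthPartnerOf i 0 z)) inferInstance] E → |(P (W ∩ A ∩ E)).toReal - u * (P (W ∩ E)).toReal| ≤ C * σ ^ p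

/-- FIRST LEMMA of card `slider-coordinates-brunn-minkowski` (rung: two FIXED-time exact-velocity
snapshots): for the equilibrium gas (flow-invariant law `P`), for every fixed intermediate time
`s ∈ (0, w]` NOT LONGER THAN ONE MEAN FREE TIME (`s ≤ (N+1)^{-1/3}/(4√π σ² √θ₀)`; beyond ≈ 2.8 mean free
times two exact-velocity snapshots pin the microstate — RIGIDITY-NOTE.md — and the statement is false),
the outgoing direction of the first collision of `i` after time `s` is near-uniform
and near-independent of (cells + exact velocities of ALL particles at time `0`, cells + exact
velocities of ALL particles at time `s`, the partner's identity), averaged form, polynomial rate.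
The second snapshot's exact velocities pin every contact normal of the collisions in `(0, s]` but
not their TIMES: the posterior is uniform in the slider coordinates (the card's lever). -/
def TwoSnapshotMarking : Prop :=
  ∀ (a₀ θ₀ : ℝ), 0 < a₀ → 0 < θ₀ → ∃ C : ℝ, 0 < C ∧ ∃ p : ℝ, 0 < p ∧ ∃ σ₀ : ℝ, 0 < σ₀ ∧ ∀ σ : ℝ, 0 < σ → σ < σ₀ → ∃ ρ : ℝ, σ ≤ ρ ∧ ρ * (Real.sqrt 2 * Real.pi * σ ^ 2) ≤ 1 ∧ ∀ τ : ℝ, 0 < τ → ∃ N₀ : ℕ, ∀ N : ℕ, N₀ ≤ N → ∀ Φ : Literature.Analysis.FluidPDE.HardSphereFlow (Literature.Analysis.FluidPDE.Torus.geometry (Fin 3)) (Literature.MathematicalPhysics.KineticTheory.hsDiameter σ N) (N + 1), ∀ (i : Fin (N + 1)) (B : Set Literature.MathematicalPhysics.KineticTheory.V3), MeasurableSet B → ∀ s : ℝ, 0 < s → s ≤ ((N + 1 : ℕ) : ℝ) ^ (-(1 / 3 : ℝ)) / (4 * Real.sqrt Real.pi * σ ^ 2 * Real.sqrt θ₀)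 → s ≤ τ * ((N + 1 : ℕ) : ℝ) ^ (-(1 / 3 : ℝ)) → let G : Literature.Analysis.FluidPDE.Geometry (Fin 3) Literature.MathematicalPhysics.KineticTheory.T3 := Literature.Analysis.FluidPDE.Torus.geometry (Fin 3); let ε : ℝ := Literature.MathematicalPhysics.KineticTheory.hsDiameter σ N; let w : ℝ := τ * ((N + 1 : ℕ) : ℝ) ^ (-(1 / 3 : ℝ)); let q : Literature.MathematicalPhysics.KineticTheory.T3 → (Fin 3 → ℤ) := Literature.Analysis.FluidPDE.Torus.coarseCell (ρ * ((N + 1 : ℕ) : ℝ) ^ (-(1 / 3 : ℝ))); let P : MeasureTheory.Measure (Literature.Analysis.FluidPDE.Config (N + 1) (Fin 3) Literature.MathematicalPhysics.KineticTheory.T3) := Literature.MathematicalPhysics.KineticTheory.localGibbsLaw σ (fun _ => a₀) (fun _ => 0) (fun _ => θ₀) N Φ; let W : Set (Literature.Analysis.FluidPDE.Config (N + 1) (Fin 3) Literature.MathematicalPhysics.KineticTheory.T3) := {z | 1 ≤ Set.ncard (Literature.Analysis.FluidPDE.collisionTimesOf G ε (fun t => Φ.flow t (Φ.flow s z)) i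 ∩ Set.Ioc 0 w)}; let A : Set (Literature.Analysis.FluidPDE.Config (N + 1) (Fin 3) Literature.MathematicalPhysics.KineticTheory.T3) := {z | (Φ.nthRecordOf i 0 (Φ.flow s z)).outDir ∈ B}; let u : ℝ := (((Literature.MathematicalPhysics.KineticTheory.sphereMeasure (E := Literature.MathematicalPhysics.KineticTheory.V3)) Set.univ)⁻¹ * (Literature.MathematicalPhysics.KineticTheory.sphereMeasure (E := Literature.MathematicalPhysics.KineticTheory.V3)) {ω | (ω : Literature.MathematicalPhysics.KineticTheory.V3) ∈ B}).toReal; ∀ E : Set (Literature.Analysis.FluidPDE.Config (N + 1) (Fin 3) Literature.MathematicalPhysics.KineticTheory.T3), MeasurableSet[MeasurableSpace.comap (fun z => (Literature.Analysis.FluidPDE.coarseConfig q z, Literature.Analysis.FluidPDE.coarseConfig q (Φ.flow s z), Φ.nthPartnerOf i 0 (Φ.flow s z))) inferInstance] E → |(P (W ∩ A ∩ E)).toReal - u * (P (W ∩ E)).toReal| ≤ C * σ ^ p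

/-- Sanity: the crux decl is in scope under its route name (the cards conclude THIS decl). -/
example : Prop :=
  Summit.AtomisticToContinuum.HydrodynamicLimit.Theses.OneFlightGossipEngine.OneFlightLayeredChaos

end Summit.AtomisticToContinuum.HydrodynamicLimit.Cruxes.OneFlightLayeredChaos.IdeatorTwo
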